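import Summits.QuantumFields.YangMills.Theorems.BalabanUVNodesN15KingModelContinuumSymbolWeights
import Literature.MathematicalPhysics.QuantumFieldTheory.King1986.TorusAliasDigits
import Literature.MathematicalPhysics.QuantumFieldTheory.Balaban1983to89.B5G183RateL2

/-!
# BalabanUVNodes ∕ N15 — THE KING-MODEL RUNG (PART Ϡ-b): THE CONTINUUM ALIAS SERIES `S_∞(p′) = Σ_{j ∈ ℤ^d} |u⁰(p′+2πj)|²∕(|p′+2πj|² + m²)` OF KING's (4.5)
# AT `η = 0` — SUMMABLE BY THE PRODUCT DOMINATION `(π∕2)^{2d}π^d·Π_μ aliasMaj 2`, AND THE LIMIT `S_N(p′) → S_∞(p′)` OF THE FINITE ALIAS SUMS OVER KING's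
# DIGIT SETS (odd `N → ∞`) BY DOMINATED CONVERGENCE (Tannery)
# (Track A, DAG node N15 = NE2; FAN-OUT v1.1 §N15 s3 «KING-MODEL RUNG … NE2's analogue DECIDED in the model»)

HONEST FRAMING.  Count-neutral (cell `pub-ymgap`, seat `pub-ymgap-dag-n15-e` g32; `--supports stmt-QuantumFields-27366 --as helper` = K3⁸
`SpineGivenEndpointR13SepCoPHV`).  TEMPLATE LITERATURE: C. King, *The U(1) Higgs model. I. The continuum limit*, Commun. Math. Phys. **102** (1986) 649–677
[King1986] — KING's OWN `A = 0` MODEL in momentum variables.  (4.5) p. 670: `Δ^{(k)}(p′) = (a_k⁻¹ + Σ_l |u^η_k(p′+l)|² Δ^η(p′+l)⁻¹)⁻¹` with the aliases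
`l ∈ 2πℤ^d`, `|l_μ| ≦ π(L^k − 1)` for `L` odd ((4.2) p. 670; tree `King1986.Torus.digitBox d N`, `N = L^k`), the weight `u^η` ((4.3); tree `uWeight`) and the
symbol `Δ^η` ((4.4); tree `latticeSymbol`); (4.20)–(4.22) p. 672: the alias sums are controlled by `Π_μ |p′_μ||(p′+l)_μ|^{−1}` (tree `aliasWeight`, `aliasMaj`,
`sum_aliasMaj_le`, `aliasBox`).  NOT Bałaban's objects; NOT a node discharge (N15 is booked through n15-a's knit, untouched here); nothing continuum-Yang–Mills
∕ ℝ⁴ ∕ OS ∕ mass-gap ∕ Clay.  0 `sorry`; standard axioms.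

THE MATHEMATICS.  At level `N` (`η = N⁻¹`, odd `N`) King's alias sum is the FINITE sum `S_N(p′) = Σ_{j ∈ digitBox d N} |u^{1∕N}(p′+2πj)|²∕Δ^{1∕N}(p′+2πj)` over
the centred digits `2|j_μ| < N`, which lie in the zone `|η(p′+2πj)_μ| ≤ π` (`zone_of_mem_digitBox`); there (4.20) gives `|u^η(p′+2πj)| ≤ (π∕2)^d·aliasWeight p′ j`
and `Δ^η ≥ m²`; `aliasWeight² ≤ π^d Π_μ aliasMaj 2 (p′_μ) (j_μ)` (tree, `B5G183RateL2`) and the tree's `sum_aliasMaj_le` at `s = 2` make the product majorant SUMMABLE over `ℤ^d` (every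
finite digit set sits in a box, where the sum factorises).  Termwise part Ϡ-a gives the limits, a fixed digit is eventually in `digitBox d N`, and Tannery's theorem
(Mathlib `tendsto_tsum_of_dominated_convergence`) gives `S_N(p′) → S_∞(p′)` along every sequence of odd `N → ∞` — in particular King's `N = L^K`, `L` odd.

WHAT THIS FILE PROVES (kernel).  §1 the terms `aliasTermAt η M p′ j = |u^η(p′+2πj)|²∕Δ^η(p′+2πj)`, `aliasTerm0 M p′ j = |u⁰(p′+2πj)|²∕(|p′+2πj|² + m²)`,
`aliasTermN` (digit cut-off), the finite sum `aliasSumN N M p′` (= King's `Σ_l`), THE CONTINUUM ALIAS SERIES `aliasSeries0 M p′ = Σ'_{j ∈ ℤ^d} aliasTerm0`.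
§2 signs; ★ `zone_of_mem_digitBox`.  §3 ★ `aliasTermAt_le_of_zone` ((4.20)²∕`m²`), `aliasWeight² ≤ π^dΠ aliasMaj 2` REUSED (`B5G183RateL2.aliasWeight_sq_le`, cell pub-balaban), ★ `sum_box_prod_aliasMaj_le` (`≤ (1 + 4∕π)^d`),
★★ **`summable_prod_aliasMaj`**, `aliasMajorant`, ★★ `aliasTermN_le_majorant` (odd `N`), ★ **`norm_uWeight0_alias_le`** ((4.20) AT `η = 0`, constant `1`),
★★ **`summable_aliasTerm0`**, `aliasTerm0_le_aliasSeries0`, `aliasSeries0_le`, `aliasSumN_le`.  §4 ★★ **`tendsto_aliasTermAt`**, `eventually_mem_digitBox`,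
★★ `tendsto_aliasTermN`.  §5 ★★★ **`tendsto_aliasSumN_of_odd`** (`S_{N_K}(p′) → S_∞(p′)`, odd `N_K → ∞`) and ★★★ **`tendsto_aliasSumN_pow`** (`N_K = L^K`, `L` odd).

HONEST SCOPE.  Momentum-space real analysis of King's printed alias sum at the endpoint `η = 0`; constants explicit but not optimised; odd `N` only (King's
«for L odd»; even `L` shifts the digit set and is not treated, as in the tree's `TorusAliasDigits`).  Nothing here is about Bałaban's covariant propagators.
N15 untouched; counts unmoved.  Locators: [King1986] (4.2)–(4.5) p.670, (4.8)∕(4.10) p.671, (4.20)–(4.23) p.672, Lemma 4.4 (4.29) p.673.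
-/

noncomputable section

open Complex Finset Filter Topology

namespace Summit.QuantumFields.YangMills.BalabanUVNodes.N15KingModelRung

open Literature.MathematicalPhysics.QuantumFieldTheory.King1986
open Literature.MathematicalPhysics.QuantumFieldTheory.King1986.Torus (digitBox mem_digitBox two_abs_lt_of_mem_digitBox
  mem_digitBox_of_two_abs_lt)
open Literature.MathematicalPhysics.QuantumFieldTheory.Balaban1983to89.B5G183RateL2 (aliasWeight_sq_le)

variable {d : ℕ}

/-! ## §1 The alias terms at spacing `η`, at `η = 0`, King's finite alias sum and the continuum alias series -/

section Terms

/-- ONE ALIAS TERM OF (4.5) at spacing `η`: `|u^η(p′+2πj)|² ∕ Δ^η(p′+2πj)` (mass `M = m²`). [cite: King1986, (4.5) p.670] -/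
def aliasTermAt (η M : ℝ) (p : Fin d → ℝ) (j : Fin d → ℤ) : ℝ :=
  ‖uWeight η (aliasPt p j)‖ ^ 2 / latticeSymbol η M (aliasPt p j)

/-- ONE ALIAS TERM AT `η = 0`: `|u⁰(p′+2πj)|² ∕ (|p′+2πj|² + m²)`. [cite: King1986, (4.5) p.670] -/
def aliasTerm0 (M : ℝ) (p : Fin d → ℝ) (j : Fin d → ℤ) : ℝ :=
  ‖uWeight0 (aliasPt p j)‖ ^ 2 / (momSq (aliasPt p j) + M)

/-- The level-`N` alias term with King's digit cut-off (`η = N⁻¹`, `j ∈ digitBox d N`, zero outside). [cite: King1986, (4.2) p.670, (4.5) p.670] -/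
def aliasTermN (N : ℕ) (M : ℝ) (p : Fin d → ℝ) (j : Fin d → ℤ) : ℝ :=
  if j ∈ digitBox d N then aliasTermAt ((N : ℝ)⁻¹) M p j else 0

/-- KING's FINITE ALIAS SUM at level `N`: `S_N(p′) = Σ_{j ∈ digitBox d N} |u^{1∕N}(p′+2πj)|²∕Δ^{1∕N}(p′+2πj)` — the `Σ_l` of (4.5) for `N = L^k` odd.
[cite: King1986, (4.2) p.670, (4.5) p.670] -/
def aliasSumN (N : ℕ) (M : ℝ) (p : Fin d → ℝ) : ℝ :=
  ∑ j ∈ digitBox d N, aliasTermAt ((N : ℝ)⁻¹) M p j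

/-- ★ THE CONTINUUM ALIAS SERIES `S_∞(p′) = Σ_{j ∈ ℤ^d} |u⁰(p′+2πj)|²∕(|p′+2πj|² + m²)` — King's (4.5) alias sum at `η = 0` (all of `2πℤ^d`).
[cite: King1986, (4.5) p.670] -/
def aliasSeries0 (M : ℝ) (p : Fin d → ℝ) : ℝ :=
  ∑' j : Fin d → ℤ, aliasTerm0 M p j

/-- The finite alias sum as a series over `ℤ^d` of the digit-cut terms. [cite: King1986, (4.2) p.670] -/
theorem tsum_aliasTermN_eq (N : ℕ) (M : ℝ) (p : Fin d → ℝ) :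
    ∑' j : Fin d → ℤ, aliasTermN N M p j = aliasSumN N M p := by
  rw [tsum_eq_sum (s := digitBox d N) (fun j hj => by simp [aliasTermN, hj])]
  exact Finset.sum_congr rfl fun j hj => by simp [aliasTermN, hj]

end Terms

/-! ## §2 Signs and the zone of the centred digits -/

section Zone

/-- `aliasTermAt ≥ 0` (`m² ≥ 0`). [cite: King1986, (4.5) p.670] -/
theorem aliasTermAt_nonneg (η : ℝ) {M : ℝ} (hM : 0 ≤ M) (p : Fin d → ℝ) (j : Fin d → ℤ) : 0 ≤ aliasTermAt η M p j :=
  div_nonneg (sq_nonneg _) (latticeSymbol_nonneg η hM _)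

/-- `aliasTerm0 ≥ 0` (`m² ≥ 0`). [cite: King1986, (4.5) p.670] -/
theorem aliasTerm0_nonneg {M : ℝ} (hM : 0 ≤ M) (p : Fin d → ℝ) (j : Fin d → ℤ) : 0 ≤ aliasTerm0 M p j :=
  div_nonneg (sq_nonneg _) (by have := momSq_nonneg (aliasPt p j); linarith)

/-- `aliasTermN ≥ 0` (`m² ≥ 0`). [cite: King1986, (4.5) p.670] -/
theorem aliasTermN_nonneg (N : ℕ) {M : ℝ} (hM : 0 ≤ M) (p : Fin d → ℝ) (j : Fin d → ℤ) : 0 ≤ aliasTermN N M p j := by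
  unfold aliasTermN; split_ifs; exacts [aliasTermAt_nonneg _ hM p j, le_rfl]

/-- `S_N(p′) ≥ 0`. [cite: King1986, (4.5) p.670] -/
theorem aliasSumN_nonneg (N : ℕ) {M : ℝ} (hM : 0 ≤ M) (p : Fin d → ℝ) : 0 ≤ aliasSumN N M p :=
  Finset.sum_nonneg fun j _ => aliasTermAt_nonneg _ hM p j

/-- ★ THE CENTRED DIGITS LIE IN THE ZONE: for odd `N`, `|p′_μ| ≤ π` and `j ∈ digitBox d N` (`2|j_μ| < N`), `|N⁻¹(p′_μ + 2πj_μ)| ≤ π`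
(`|p′_μ + 2πj_μ| ≤ π + π(N − 1) = πN`) — why King takes `|l_μ| ≦ π(L^k − 1)` «for L odd». [cite: King1986, (4.2) p.670] -/
theorem zone_of_mem_digitBox {N : ℕ} (hN : Odd N) {p : Fin d → ℝ} (hp : ∀ μ, |p μ| ≤ Real.pi) {j : Fin d → ℤ}
    (hj : j ∈ digitBox d N) (μ : Fin d) : |(N : ℝ)⁻¹ * aliasPt p j μ| ≤ Real.pi := by
  have hN0 : (0 : ℝ) < N := by exact_mod_cast hN.pos
  have h2 : 2 * |j μ| < (N : ℤ) := two_abs_lt_of_mem_digitBox N hN hj μ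
  have h2' : 2 * |((j μ : ℤ) : ℝ)| ≤ (N : ℝ) - 1 := by
    have h3 : 2 * |j μ| ≤ (N : ℤ) - 1 := by omega
    have h4 := (Int.cast_le (R := ℝ)).mpr h3
    push_cast at h4
    exact h4
  have hq : |aliasPt p j μ| ≤ Real.pi * N := by
    unfold aliasPt
    calc |p μ + 2 * Real.pi * (j μ : ℝ)| ≤ |p μ| + |2 * Real.pi * (j μ : ℝ)| := abs_add_le _ _
      _ = |p μ| + 2 * Real.pi * |(j μ : ℝ)| := by
          rw [abs_mul, abs_of_pos Real.two_pi_pos]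
      _ ≤ Real.pi + Real.pi * ((N : ℝ) - 1) := by nlinarith [hp μ, Real.pi_pos]
      _ = Real.pi * N := by ring
  rw [abs_mul, abs_inv, abs_of_pos hN0, inv_mul_le_iff₀ hN0]
  linarith

end Zone

/-! ## §3 The summable majorant: (4.20)² ∕ m², `aliasWeight² ≤ π^d Π aliasMaj 2`, box sums, summability -/

section Majorant

/-- ★ (4.20) SQUARED OVER `m²`: in the zone, `|u^η(p′+2πj)|²∕Δ^η(p′+2πj) ≤ (π∕2)^{2d}·aliasWeight(p′,j)²∕m²` (`η > 0`, `m² > 0`, `|p′_μ| ≤ π`).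
[cite: King1986, (4.20)–(4.21) p.672] -/
theorem aliasTermAt_le_of_zone {η M : ℝ} (hη : 0 < η) (hM : 0 < M) {p : Fin d → ℝ} (hp : ∀ μ, |p μ| ≤ Real.pi) (j : Fin d → ℤ)
    (hz : ∀ μ, |η * aliasPt p j μ| ≤ Real.pi) :
    aliasTermAt η M p j ≤ (Real.pi / 2) ^ (2 * d) * aliasWeight p j ^ 2 / M := by
  unfold aliasTermAt
  have hu : ‖uWeight η (aliasPt p j)‖ ≤ (Real.pi / 2) ^ d * aliasWeight p j := norm_uWeight_alias_le hη hp j hz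
  have hS : M ≤ latticeSymbol η M (aliasPt p j) := mass_le_latticeSymbol η M _
  have hu2 : ‖uWeight η (aliasPt p j)‖ ^ 2 ≤ ((Real.pi / 2) ^ d * aliasWeight p j) ^ 2 :=
    pow_le_pow_left₀ (norm_nonneg _) hu 2
  calc ‖uWeight η (aliasPt p j)‖ ^ 2 / latticeSymbol η M (aliasPt p j)
      ≤ ((Real.pi / 2) ^ d * aliasWeight p j) ^ 2 / M := by
        gcongr
    _ = (Real.pi / 2) ^ (2 * d) * aliasWeight p j ^ 2 / M := by ring

/-- The one-coordinate majorant sum at `s = 2`: `Σ_{|i| ≤ N} aliasMaj 2 p i ≤ 1 + 4∕π` for `|p| ≤ π`, uniformly in `N` (the tree's `sum_aliasMaj_le`).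
[cite: King1986, (4.22) p.672] -/
theorem sum_Icc_aliasMaj_two_le {p : ℝ} (hp : |p| ≤ Real.pi) (N : ℕ) :
    ∑ i ∈ Finset.Icc (-(N : ℤ)) N, aliasMaj 2 p i ≤ 1 + 4 / Real.pi := by
  have h := sum_aliasMaj_le (s := 2) (by norm_num) hp N
  have e : (2 : ℝ) * Real.pi ^ (1 - (2 : ℝ)) * ((2 : ℝ) / (2 - 1)) = 4 / Real.pi := by
    rw [show (1 : ℝ) - 2 = -1 by norm_num, Real.rpow_neg_one]; ring
  linarith

/-- ★ THE BOX SUMS FACTORISE AND ARE BOUNDED: `Σ_{j ∈ [−N,N]^d} Π_μ aliasMaj 2 (p′_μ) (j_μ) ≤ (1 + 4∕π)^d` for `|p′_μ| ≤ π`, uniformly in `N`.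
[cite: King1986, (4.22) p.672] -/
theorem sum_box_prod_aliasMaj_le {p : Fin d → ℝ} (hp : ∀ μ, |p μ| ≤ Real.pi) (N : ℕ) :
    ∑ j ∈ aliasBox d N, ∏ μ, aliasMaj 2 (p μ) (j μ) ≤ (1 + 4 / Real.pi) ^ d := by
  unfold aliasBox
  rw [← Finset.prod_univ_sum]
  calc ∏ μ : Fin d, ∑ i ∈ Finset.Icc (-(N : ℤ)) N, aliasMaj 2 (p μ) i ≤ ∏ _μ : Fin d, (1 + 4 / Real.pi) :=
        Finset.prod_le_prod (fun μ _ => Finset.sum_nonneg fun i _ => aliasMaj_nonneg _ _ _)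
          (fun μ _ => sum_Icc_aliasMaj_two_le (hp μ) N)
    _ = (1 + 4 / Real.pi) ^ d := by rw [Finset.prod_const, Finset.card_univ, Fintype.card_fin]

omit d in
/-- Every finite set of integer vectors sits in a box `[−N, N]^d`. [cite: King1986, (4.22) p.672] -/
theorem exists_subset_aliasBox {dd : ℕ} (u : Finset (Fin dd → ℤ)) : ∃ N : ℕ, u ⊆ aliasBox dd N := by
  classical
  obtain ⟨N, hN⟩ : ∃ N : ℕ, ∀ j ∈ u, ∀ μ, |j μ| ≤ N := by
    refine ⟨u.sup fun j => Finset.univ.sup fun μ => (j μ).natAbs, fun j hj μ => ?_⟩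
    have h1 : (j μ).natAbs ≤ Finset.univ.sup fun μ => (j μ).natAbs :=
      Finset.le_sup (f := fun μ => (j μ).natAbs) (Finset.mem_univ μ)
    have h2 : (Finset.univ.sup fun μ => (j μ).natAbs) ≤ u.sup fun j => Finset.univ.sup fun μ => (j μ).natAbs :=
      Finset.le_sup (f := fun j => Finset.univ.sup fun μ => (j μ).natAbs) hj
    have := h1.trans h2
    rw [← Int.natCast_natAbs]
    exact_mod_cast this
  refine ⟨N, fun j hj => ?_⟩
  unfold aliasBox
  rw [Fintype.mem_piFinset]
  exact fun μ => Finset.mem_Icc.mpr (abs_le.1 (hN j hj μ))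

/-- ★★ **THE PRODUCT MAJORANT IS SUMMABLE OVER `ℤ^d`** (`|p′_μ| ≤ π`): every finite partial sum sits in a box, where it is `≤ (1 + 4∕π)^d`.
[cite: King1986, (4.22) p.672] -/
theorem summable_prod_aliasMaj {p : Fin d → ℝ} (hp : ∀ μ, |p μ| ≤ Real.pi) :
    Summable (fun j : Fin d → ℤ => ∏ μ, aliasMaj 2 (p μ) (j μ)) := by
  refine summable_of_sum_le (c := (1 + 4 / Real.pi) ^ d) (fun j => Finset.prod_nonneg fun μ _ => aliasMaj_nonneg _ _ _) fun u => ?_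
  obtain ⟨N, hN⟩ := exists_subset_aliasBox u
  exact (Finset.sum_le_sum_of_subset_of_nonneg hN fun j _ _ => Finset.prod_nonneg fun μ _ => aliasMaj_nonneg _ _ _).trans
    (sum_box_prod_aliasMaj_le hp N)

/-- `Σ_{j ∈ ℤ^d} Π_μ aliasMaj 2 (p′_μ) (j_μ) ≤ (1 + 4∕π)^d`. [cite: King1986, (4.22) p.672] -/
theorem tsum_prod_aliasMaj_le {p : Fin d → ℝ} (hp : ∀ μ, |p μ| ≤ Real.pi) :
    ∑' j : Fin d → ℤ, ∏ μ, aliasMaj 2 (p μ) (j μ) ≤ (1 + 4 / Real.pi) ^ d := by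
  refine Real.tsum_le_of_sum_le (fun j => Finset.prod_nonneg fun μ _ => aliasMaj_nonneg _ _ _) fun u => ?_
  obtain ⟨N, hN⟩ := exists_subset_aliasBox u
  exact (Finset.sum_le_sum_of_subset_of_nonneg hN fun j _ _ => Finset.prod_nonneg fun μ _ => aliasMaj_nonneg _ _ _).trans
    (sum_box_prod_aliasMaj_le hp N)

/-- THE MAJORANT of the alias terms: `(π∕2)^{2d}π^d∕m² · Π_μ aliasMaj 2 (p′_μ) (j_μ)`. [cite: King1986, (4.20)–(4.22) p.672] -/
def aliasMajorant (M : ℝ) (p : Fin d → ℝ) (j : Fin d → ℤ) : ℝ :=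
  (Real.pi / 2) ^ (2 * d) * Real.pi ^ d / M * ∏ μ, aliasMaj 2 (p μ) (j μ)

/-- `aliasMajorant ≥ 0` (`m² > 0`). [cite: King1986, (4.22) p.672] -/
theorem aliasMajorant_nonneg {M : ℝ} (hM : 0 < M) (p : Fin d → ℝ) (j : Fin d → ℤ) : 0 ≤ aliasMajorant M p j := by
  unfold aliasMajorant
  exact mul_nonneg (by positivity) (Finset.prod_nonneg fun μ _ => aliasMaj_nonneg _ _ _)

/-- ★ The majorant is summable over `ℤ^d` (`|p′_μ| ≤ π`). [cite: King1986, (4.22) p.672] -/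
theorem summable_aliasMajorant (M : ℝ) {p : Fin d → ℝ} (hp : ∀ μ, |p μ| ≤ Real.pi) : Summable (aliasMajorant M p) :=
  (summable_prod_aliasMaj hp).mul_left _

/-- `Σ_j aliasMajorant ≤ (π∕2)^{2d}π^d(1 + 4∕π)^d∕m²`. [cite: King1986, (4.22) p.672] -/
theorem tsum_aliasMajorant_le {M : ℝ} (hM : 0 < M) {p : Fin d → ℝ} (hp : ∀ μ, |p μ| ≤ Real.pi) :
    ∑' j : Fin d → ℤ, aliasMajorant M p j ≤ (Real.pi / 2) ^ (2 * d) * Real.pi ^ d / M * (1 + 4 / Real.pi) ^ d := by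
  unfold aliasMajorant
  rw [tsum_mul_left]
  exact mul_le_mul_of_nonneg_left (tsum_prod_aliasMaj_le hp) (by positivity)

/-- ★★ **DOMINATION OF THE LEVEL-`N` TERMS** (odd `N`, `m² > 0`, `|p′_μ| ≤ π`): `aliasTermN N M p′ j ≤ aliasMajorant M p′ j` for EVERY `j ∈ ℤ^d`, uniformly in `N`.
[cite: King1986, (4.20)–(4.22) p.672] -/
theorem aliasTermN_le_majorant {N : ℕ} (hN : Odd N) {M : ℝ} (hM : 0 < M) {p : Fin d → ℝ} (hp : ∀ μ, |p μ| ≤ Real.pi) (j : Fin d → ℤ) :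
    aliasTermN N M p j ≤ aliasMajorant M p j := by
  unfold aliasTermN
  split_ifs with hj
  · have hN0 : (0 : ℝ) < N := by exact_mod_cast hN.pos
    have hη : 0 < (N : ℝ)⁻¹ := inv_pos.mpr hN0
    have hz : ∀ μ, |(N : ℝ)⁻¹ * aliasPt p j μ| ≤ Real.pi := fun μ => zone_of_mem_digitBox hN hp hj μ
    have hw := aliasWeight_sq_le hp j
    calc aliasTermAt (N : ℝ)⁻¹ M p j ≤ (Real.pi / 2) ^ (2 * d) * aliasWeight p j ^ 2 / M := aliasTermAt_le_of_zone hη hM hp j hz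
      _ ≤ (Real.pi / 2) ^ (2 * d) * (Real.pi ^ d * ∏ μ, aliasMaj 2 (p μ) (j μ)) / M := by gcongr
      _ = aliasMajorant M p j := by unfold aliasMajorant; ring
  · exact aliasMajorant_nonneg hM p j

/-- ★ **(4.20) AT `η = 0` WITH CONSTANT `1`**: `|u⁰(p′+2πj)| ≤ aliasWeight p′ j` for `|p′_μ| ≤ π` — on an active coordinate `|e^{−i(p′+2πj)_μ} − 1| =
|e^{−ip′_μ} − 1| ≤ |p′_μ|` (`2π`-periodicity) over `|(p′+2πj)_μ|`; on an inactive one `|f₀| ≤ 1`. [cite: King1986, (4.20) p.672] -/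
theorem norm_uWeight0_alias_le {p : Fin d → ℝ} (hp : ∀ μ, |p μ| ≤ Real.pi) (j : Fin d → ℤ) :
    ‖uWeight0 (aliasPt p j)‖ ≤ aliasWeight p j := by
  rw [norm_uWeight0]
  unfold aliasWeight
  refine Finset.prod_le_prod (fun μ _ => norm_nonneg _) fun μ _ => ?_
  by_cases hμ : j μ = 0
  · rw [if_pos hμ]
    exact norm_uFac0_le _
  · rw [if_neg hμ]
    have hq : Real.pi ≤ |p μ + 2 * Real.pi * j μ| := pi_le_abs_add (hp μ) hμ
    have hq0 : p μ + 2 * Real.pi * (j μ : ℝ) ≠ 0 := by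
      intro h; rw [h, abs_zero] at hq; linarith [Real.pi_pos]
    show ‖uFac0 (p μ + 2 * Real.pi * (j μ : ℝ))‖ ≤ |p μ| / |p μ + 2 * Real.pi * (j μ : ℝ)|
    unfold uFac0
    rw [if_neg hq0, norm_div, norm_fdq0]
    have hper : Complex.exp (I * ((-(p μ + 2 * Real.pi * (j μ : ℝ)) : ℝ) : ℂ)) = Complex.exp (I * ((-(p μ) : ℝ) : ℂ)) := by
      have h : I * ((-(p μ + 2 * Real.pi * (j μ : ℝ)) : ℝ) : ℂ) = I * ((-(p μ) : ℝ) : ℂ) + ((-(j μ) : ℤ) : ℂ) * (2 * Real.pi * I) := by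
        push_cast; ring
      rw [h, Complex.exp_add, Complex.exp_int_mul_two_pi_mul_I, mul_one]
    rw [hper]
    exact div_le_div_of_nonneg_right (norm_cexp_neg_sub_one_le (p μ)) (abs_nonneg _)

/-- ★ Domination of the `η = 0` terms: `aliasTerm0 M p′ j ≤ aliasMajorant M p′ j` (`m² > 0`, `|p′_μ| ≤ π`). [cite: King1986, (4.20)–(4.22) p.672] -/
theorem aliasTerm0_le_majorant {M : ℝ} (hM : 0 < M) {p : Fin d → ℝ} (hp : ∀ μ, |p μ| ≤ Real.pi) (j : Fin d → ℤ) :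
    aliasTerm0 M p j ≤ aliasMajorant M p j := by
  unfold aliasTerm0
  have hw : ‖uWeight0 (aliasPt p j)‖ ≤ aliasWeight p j := norm_uWeight0_alias_le hp j
  have hw2 : ‖uWeight0 (aliasPt p j)‖ ^ 2 ≤ aliasWeight p j ^ 2 := pow_le_pow_left₀ (norm_nonneg _) hw 2
  have hden : M ≤ momSq (aliasPt p j) + M := by linarith [momSq_nonneg (aliasPt p j)]
  have hsq := aliasWeight_sq_le hp j
  have hc : (1 : ℝ) ≤ (Real.pi / 2) ^ (2 * d) := one_le_pow₀ (by linarith [Real.pi_gt_three])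
  have hP : 0 ≤ Real.pi ^ d * ∏ μ, aliasMaj 2 (p μ) (j μ) := mul_nonneg (by positivity) (Finset.prod_nonneg fun μ _ => aliasMaj_nonneg _ _ _)
  calc ‖uWeight0 (aliasPt p j)‖ ^ 2 / (momSq (aliasPt p j) + M) ≤ aliasWeight p j ^ 2 / M := by gcongr
    _ ≤ (Real.pi ^ d * ∏ μ, aliasMaj 2 (p μ) (j μ)) / M := by gcongr
    _ ≤ (Real.pi / 2) ^ (2 * d) * ((Real.pi ^ d * ∏ μ, aliasMaj 2 (p μ) (j μ)) / M) :=
        le_mul_of_one_le_left (div_nonneg hP hM.le) hc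
    _ = aliasMajorant M p j := by unfold aliasMajorant; ring

/-- ★★ **THE CONTINUUM ALIAS SERIES CONVERGES**: `j ↦ |u⁰(p′+2πj)|²∕(|p′+2πj|² + m²)` is summable over `ℤ^d` (`m² > 0`, `|p′_μ| ≤ π`).
[cite: King1986, (4.5) p.670, (4.22) p.672] -/
theorem summable_aliasTerm0 {M : ℝ} (hM : 0 < M) {p : Fin d → ℝ} (hp : ∀ μ, |p μ| ≤ Real.pi) : Summable (aliasTerm0 M p) :=
  (summable_aliasMajorant M hp).of_nonneg_of_le (fun j => aliasTerm0_nonneg hM.le p j) fun j => aliasTerm0_le_majorant hM hp j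

/-- `S_∞(p′) ≥ 0`. [cite: King1986, (4.5) p.670] -/
theorem aliasSeries0_nonneg {M : ℝ} (hM : 0 ≤ M) (p : Fin d → ℝ) : 0 ≤ aliasSeries0 M p :=
  tsum_nonneg fun j => aliasTerm0_nonneg hM p j

/-- Each term is below the series: `|u⁰(p′+2πj)|²∕(|p′+2πj|² + m²) ≤ S_∞(p′)`; in particular (`j = 0`) `|u⁰(p′)|²∕(|p′|² + m²) ≤ S_∞(p′)`.
[cite: King1986, (4.5) p.670] -/
theorem aliasTerm0_le_aliasSeries0 {M : ℝ} (hM : 0 < M) {p : Fin d → ℝ} (hp : ∀ μ, |p μ| ≤ Real.pi) (j : Fin d → ℤ) :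
    aliasTerm0 M p j ≤ aliasSeries0 M p :=
  (summable_aliasTerm0 hM hp).le_tsum j fun i _ => aliasTerm0_nonneg hM.le p i

/-- `S_∞(p′) ≤ (π∕2)^{2d}π^d(1 + 4∕π)^d∕m²` (`m² > 0`, `|p′_μ| ≤ π`). [cite: King1986, (4.22) p.672] -/
theorem aliasSeries0_le {M : ℝ} (hM : 0 < M) {p : Fin d → ℝ} (hp : ∀ μ, |p μ| ≤ Real.pi) :
    aliasSeries0 M p ≤ (Real.pi / 2) ^ (2 * d) * Real.pi ^ d / M * (1 + 4 / Real.pi) ^ d :=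
  ((summable_aliasTerm0 hM hp).tsum_le_tsum (fun j => aliasTerm0_le_majorant hM hp j) (summable_aliasMajorant M hp)).trans
    (tsum_aliasMajorant_le hM hp)

/-- `S_N(p′) ≤ (π∕2)^{2d}π^d(1 + 4∕π)^d∕m²` for odd `N`, uniformly (`m² > 0`, `|p′_μ| ≤ π`). [cite: King1986, (4.22) p.672] -/
theorem aliasSumN_le {N : ℕ} (hN : Odd N) {M : ℝ} (hM : 0 < M) {p : Fin d → ℝ} (hp : ∀ μ, |p μ| ≤ Real.pi) :
    aliasSumN N M p ≤ (Real.pi / 2) ^ (2 * d) * Real.pi ^ d / M * (1 + 4 / Real.pi) ^ d := by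
  rw [← tsum_aliasTermN_eq]
  have hs : Summable (aliasTermN N M p) :=
    (summable_aliasMajorant M hp).of_nonneg_of_le (fun j => aliasTermN_nonneg N hM.le p j) fun j => aliasTermN_le_majorant hN hM hp j
  exact (hs.tsum_le_tsum (fun j => aliasTermN_le_majorant hN hM hp j) (summable_aliasMajorant M hp)).trans (tsum_aliasMajorant_le hM hp)

end Majorant

/-! ## §4 Termwise limits along `N → ∞` -/

section Termwise

/-- `N⁻¹ → 0⁺` along `N → ∞` (within the positive reals). [cite: King1986, (4.2) p.670 (η = L^{−k})] -/
theorem tendsto_inv_natCast_nhdsWithin : Tendsto (fun N : ℕ => ((N : ℝ))⁻¹) atTop (𝓝[>] (0 : ℝ)) := by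
  rw [tendsto_nhdsWithin_iff]
  refine ⟨tendsto_inv_atTop_nhds_zero_nat (𝕜 := ℝ), ?_⟩
  filter_upwards [eventually_ge_atTop 1] with N hN
  have hN0 : (0 : ℝ) < N := Nat.cast_pos.mpr (by omega)
  exact inv_pos.mpr hN0

/-- ★★ **THE TERMWISE LIMIT**: for fixed `p′`, `j` and `m² > 0`, `|u^{1∕N}(p′+2πj)|²∕Δ^{1∕N}(p′+2πj) → |u⁰(p′+2πj)|²∕(|p′+2πj|² + m²)` as `N → ∞`.
[cite: King1986, (4.3)–(4.5) p.670, Lemma 4.4 (4.29) p.673] -/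
theorem tendsto_aliasTermAt {M : ℝ} (hM : 0 < M) (p : Fin d → ℝ) (j : Fin d → ℤ) :
    Tendsto (fun N : ℕ => aliasTermAt ((N : ℝ)⁻¹) M p j) atTop (𝓝 (aliasTerm0 M p j)) := by
  have hne : momSq (aliasPt p j) + M ≠ 0 := by
    have := momSq_nonneg (aliasPt p j)
    positivity
  have h : Tendsto (fun η : ℝ => ‖uWeight η (aliasPt p j)‖ ^ 2 / latticeSymbol η M (aliasPt p j)) (𝓝[>] 0)
      (𝓝 (‖uWeight0 (aliasPt p j)‖ ^ 2 / (momSq (aliasPt p j) + M))) :=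
    (tendsto_norm_sq_uWeight_zero (aliasPt p j)).div (tendsto_latticeSymbol_zero M (aliasPt p j)) hne
  exact h.comp tendsto_inv_natCast_nhdsWithin

/-- A fixed digit is eventually inside King's digit box: `2|j_μ| < N` for all `μ` once `N` is large. [cite: King1986, (4.2) p.670] -/
theorem eventually_mem_digitBox (j : Fin d → ℤ) : ∀ᶠ N : ℕ in atTop, j ∈ digitBox d N := by
  have h : ∀ μ, ∀ᶠ N : ℕ in atTop, 2 * |j μ| < (N : ℤ) := fun μ =>
    (tendsto_natCast_atTop_atTop (R := ℤ)).eventually_gt_atTop (2 * |j μ|)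
  filter_upwards [eventually_all.mpr h] with N hN
  exact mem_digitBox_of_two_abs_lt N hN

/-- ★★ The digit-cut terms converge too: `aliasTermN N M p′ j → aliasTerm0 M p′ j` as `N → ∞` (fixed `j`). [cite: King1986, (4.2)–(4.5) p.670] -/
theorem tendsto_aliasTermN {M : ℝ} (hM : 0 < M) (p : Fin d → ℝ) (j : Fin d → ℤ) :
    Tendsto (fun N : ℕ => aliasTermN N M p j) atTop (𝓝 (aliasTerm0 M p j)) := by
  refine (tendsto_aliasTermAt hM p j).congr' ?_
  filter_upwards [eventually_mem_digitBox j] with N hN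
  rw [aliasTermN, if_pos hN]

end Termwise

/-! ## §5 Tannery: `S_N(p′) → S_∞(p′)` along odd `N → ∞` -/

section Limit

/-- ★★★ **THE ALIAS SUM OF (4.5) CONVERGES TO THE CONTINUUM ALIAS SERIES**: for `m² > 0`, `|p′_μ| ≤ π` and every sequence of ODD levels `N_K → ∞`,
`S_{N_K}(p′) = Σ_{j ∈ digitBox d N_K} |u^{1∕N_K}(p′+2πj)|²∕Δ^{1∕N_K}(p′+2πj) → S_∞(p′) = Σ_{j ∈ ℤ^d} |u⁰(p′+2πj)|²∕(|p′+2πj|² + m²)` — dominated convergence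
over `ℤ^d` (Tannery) with the summable majorant `aliasMajorant`. [cite: King1986, (4.5) p.670, (4.20)–(4.22) p.672, Lemma 4.4 (4.29) p.673] -/
theorem tendsto_aliasSumN_of_odd {M : ℝ} (hM : 0 < M) {p : Fin d → ℝ} (hp : ∀ μ, |p μ| ≤ Real.pi) {Nseq : ℕ → ℕ}
    (hodd : ∀ K, Odd (Nseq K)) (hlim : Tendsto Nseq atTop atTop) :
    Tendsto (fun K => aliasSumN (Nseq K) M p) atTop (𝓝 (aliasSeries0 M p)) := by
  have h := tendsto_tsum_of_dominated_convergence (𝓕 := atTop) (f := fun K j => aliasTermN (Nseq K) M p j)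
    (g := aliasTerm0 M p) (summable_aliasMajorant M hp) (fun j => (tendsto_aliasTermN hM p j).comp hlim)
    (Eventually.of_forall fun K j => by
      rw [Real.norm_eq_abs, abs_of_nonneg (aliasTermN_nonneg _ hM.le p j)]
      exact aliasTermN_le_majorant (hodd K) hM hp j)
  refine (h.congr fun K => ?_)
  exact tsum_aliasTermN_eq (Nseq K) M p

/-- ★★★ **KING's SCALING `N_K = L^K`, `L` odd, `L ≥ 3`**: `S_{L^K}(p′) → S_∞(p′)` as `K → ∞` (`m² > 0`, `|p′_μ| ≤ π`). [cite: King1986, (4.2)–(4.5) p.670] -/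
theorem tendsto_aliasSumN_pow {L : ℕ} (hLodd : Odd L) (hL : 2 ≤ L) {M : ℝ} (hM : 0 < M) {p : Fin d → ℝ} (hp : ∀ μ, |p μ| ≤ Real.pi) :
    Tendsto (fun K : ℕ => aliasSumN (L ^ K) M p) atTop (𝓝 (aliasSeries0 M p)) :=
  tendsto_aliasSumN_of_odd hM hp (fun K => hLodd.pow) (tendsto_pow_atTop_atTop_of_one_lt (by omega))

end Limit

end Summit.QuantumFields.YangMills.BalabanUVNodes.N15KingModelRung

end
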